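import Mathlib
import HarnessLib
import Summits.Ventures.LatticeQCDFlow.Exactness.LatticeCoordAvg
import Summits.Ventures.LatticeQCDFlow.Exactness.LatticeSiteResampling
import Summits.Ventures.LatticeQCDFlow.Scaling.AutoregressiveMarkovContext
import Summits.Ventures.LatticeQCDFlow.Scaling.KernelCompositionTP2

/-!
# LatticeQCDFlow / Scaling — faithfulness THROUGH the integrated block: a retained variable reached
# from the current one along a path of integrated variables is read by the exact autoregressive
# conditional unless the COMPOSED kernel is of product form

HONEST FRAMING: exact (Metropolis-corrected) sampling algorithms for lattice gauge theory;
figures of merit are autocorrelation/cost numbers at stated couplings and volumes; no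
continuum-physics claim.

Venture `LatticeQCDFlow` (cell pub-lqcd), topic `Scaling`, FANOUT row 30 (lean-1, GEN-17) — OUR WORK on
THEORY-2.md §4 conjecture C5 ("the exact KR map has EXACTLY the symbolic sparsity").  GEN-16's lower
bound (`Scaling/AutoregressiveBondFaithful`) covers a retained variable `j` bonded DIRECTLY to the
current variable `a`; the frontier variables reached only THROUGH the integrated block `s` (the fill
edges of the elimination graph — C5 proper) were not covered.  In the coordinate-average form of the
tree (`A_s w = Exactness.coordAvg μ s w`; exact conditional `A_s w / A_{insert a s} w`), any index set,
measurable space `X` and reference probability measure `μ`: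

* §0 toolbox (measurable versions of `Exactness/LatticeCoordAvg` §2): `coordAvg_singleton_of_measurable`,
  the tower **`coordAvg_insert_of_bounded`** (`A_{insert k s} = A_s ∘ A_k`), `coordAvg_eq_of_reads`.
* §1 **`path_productForm_of_arConditional_blind`** — `w = f₀ · w₁ · w₂` with `f₀` reading only
  `{a, j} ∪ T` (the path factor: every term touching the integrated path `T` from `a` to `j`), `w₁`
  blind to `j` and `T`, `w₂` blind to `a` and `s`, non-vanishing as in GEN-16.  IF the exact conditional
  of `a` does not read `j`, THEN the COMPOSED kernel `K(v, r) = A_s f₀ (φ[a ↦ v][j ↦ r])` is of product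
  form (independent blocks `A_s(f₀ w₁) = A_s f₀ · A_s w₁`, `Scaling/AutoregressiveMarkovContext`; then
  GEN-16's double ratio).  Contrapositive **`arConditional_reads_path`**.
* §2 the path factor `pathFactor F [(p₁,g₁,b₁), …, (p_k,g_k,b_k)] j v η =
  F(v, η p₁) g₁(η p₁) b₁(η p₁, η p₂) ⋯ g_k(η p_k) b_k(η p_k, η j)` (what it reads; joint measurability;
  bounds) and **`coordAvg_pathFactor`**: integrating its sites gives the composed kernel of
  `Scaling/KernelCompositionTP2` — `A_{p₁…p_k} (η ↦ pathFactor F path j (η a) η) (ω) =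
  pathKernel μ F [(g₁,b₁),…] (ω a) (ω j)` (tower + one-site integration, induction on the path).
* §3 (sequel `Scaling/AutoregressiveRingFaithful`) assembles §1–§2 with `pathKernel_not_productForm`:
  strictly TP₂ bonds along an integrated path ⇒ the exact conditional of `a` READS `j`; the ring.

READING (value-free, C5): the fill edge of the elimination graph IS read in one dimension — the first
lower bound through the integrated block.  NOT CLAIMED: `d ≥ 2` (there the path interior is read by
other retained variables; needs multivariate total positivity); gauge links.  Elementary over the
parents; `def pathFactor`; nothing is cited as a fact; no `sorry`.
-/

noncomputable section

namespace Summit.Ventures.LatticeQCDFlow.Theory2.Autoregressive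

open MeasureTheory Function Set
open Summit.Ventures.LatticeQCDFlow.Exactness

variable {ι : Type*} [Fintype ι] [DecidableEq ι]
variable {X : Type*} [MeasurableSpace X]
variable (μ : Measure X) [IsProbabilityMeasure μ]

/-! ## §0 Toolbox: one-site integration, the tower, and dropping unread integrated coordinates -/

/-- **`A_k G(ω) = ∫ G(ω[k ← v]) dμ(v)`** for measurable `G` (measurable version of
`Exactness.coordAvg_singleton`). [ours] -/
theorem coordAvg_singleton_of_measurable (k : ι) {G : (ι → X) → ℝ} (hG : Measurable G) (ω : ι → X) :
    coordAvg μ {k} G ω = ∫ v, G (update ω k v) ∂μ := by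
  unfold coordAvg
  simp only [Finset.piecewise_singleton]
  have hev := (measurePreserving_eval (fun _ : ι => μ) k).map_eq
  have hm : Measurable fun v : X => G (update ω k v) := hG.comp (measurable_update ω)
  have h1 : ∫ v, G (update ω k v) ∂μ =
      ∫ v, G (update ω k v) ∂(Measure.map (eval k) (Measure.pi fun _ : ι => μ)) := by rw [hev]
  rw [h1, integral_map (measurable_pi_apply k).aemeasurable hm.aestronglyMeasurable]

/-- **The tower `A_{insert k s} = A_s ∘ A_k`** for `k ∉ s` and bounded measurable `G` (measurable
version of `Exactness.coordAvg_insert`: redraw the `k`-th coordinate, `LatticeSiteResampling`). [ours] -/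
theorem coordAvg_insert_of_bounded {k : ι} {s : Finset ι} (hk : k ∉ s) {G : (ι → X) → ℝ}
    (hG : Measurable G) {C : ℝ} (hC : ∀ η, |G η| ≤ C) (ω : ι → X) :
    coordAvg μ (insert k s) G ω = coordAvg μ s (coordAvg μ {k} G) ω := by
  have huniv : (fun _ : ι => μ) k Set.univ ≠ 0 := by simp
  have hmeas : Measurable fun ω' : ι → X => G ((insert k s).piecewise ω' ω) :=
    hG.comp (measurable_piecewise_left (insert k s) ω)
  have hint : Integrable (fun ω' : ι → X => G ((insert k s).piecewise ω' ω))
      (Measure.pi fun _ : ι => μ) :=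
    Integrable.mono' (integrable_const C) hmeas.aestronglyMeasurable
      (ae_of_all _ fun ω' => by rw [Real.norm_eq_abs]; exact hC _)
  have hL := integral_pi_eq_integral_integral_update' (fun _ : ι => μ) k huniv hint
  simp only [measure_univ, inv_one, ENNReal.toReal_one, one_smul] at hL
  have hglue : ∀ (ω' : ι → X) (v : X),
      (insert k s).piecewise (update ω' k v) ω = update (s.piecewise ω' ω) k v := by
    intro ω' v
    rw [Finset.piecewise_insert, update_self]
    congr 1
    exact s.piecewise_congr (fun i hi => update_of_ne (ne_of_mem_of_not_mem hi hk) _ _)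
      fun _ _ => rfl
  unfold coordAvg
  rw [hL]
  refine integral_congr_ae (ae_of_all _ fun ω' => ?_)
  simp only [hglue]
  rw [show (∫ ω'', G (({k} : Finset ι).piecewise ω'' (s.piecewise ω' ω))
      ∂Measure.pi fun _ : ι => μ) = coordAvg μ {k} G (s.piecewise ω' ω) from rfl,
    coordAvg_singleton_of_measurable μ k hG]

omit [IsProbabilityMeasure μ] in
/-- **Integrated coordinates that `w` does not read can be dropped**: if `T ⊆ s` and every coordinate
of `s` read by `w` lies in `T`, then `A_s w = A_T w`. [ours] -/
theorem coordAvg_eq_of_reads (s T : Finset ι) (hTs : T ⊆ s) {w : (ι → X) → ℝ} {V : Set ι}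
    (hw : DependsOn w V) (hV : ∀ i ∈ s, i ∈ V → i ∈ T) (ω : ι → X) :
    coordAvg μ s w ω = coordAvg μ T w ω := by
  unfold coordAvg
  congr 1
  funext ω'
  refine hw fun i hi => ?_
  by_cases hiT : i ∈ T
  · rw [Finset.piecewise_eq_of_mem _ _ _ (hTs hiT), Finset.piecewise_eq_of_mem _ _ _ hiT]
  · have his : i ∉ s := fun h => hiT (hV i h hi)
    rw [Finset.piecewise_eq_of_notMem _ _ _ his, Finset.piecewise_eq_of_notMem _ _ _ hiT]

/-! ## §1 Blind to a variable reached through the block ⇒ the COMPOSED kernel is of product form -/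

/-- **IF THE EXACT CONDITIONAL OF `a` DOES NOT READ THE RETAINED VARIABLE `j`, THE COMPOSED KERNEL
BETWEEN THEM IS OF PRODUCT FORM.**  `w = f₀ · w₁ · w₂`; `f₀` reads only `{a, j} ∪ T` (the path factor:
`T` the integrated path); `w₁` reads only `V₁` with `j ∉ V₁`, `V₁ ∩ T = ∅`; `w₂` reads only `V₂` with `a ∉ V₂`,
`V₂ ∩ s = ∅`; `a, j ∉ s`, `j ≠ a`; the values of `w₂`, `A_s w₁`, `A_{insert a s} w` involved non-zero.
If `A_s w / A_{insert a s} w` takes the same value on any two configurations agreeing off `j`, then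
`K u t · K u' t' = K u t' · K u' t` for the composed kernel `K v r = A_s f₀ (φ[a ↦ v][j ↦ r])`. [ours] -/
theorem path_productForm_of_arConditional_blind (s : Finset ι) {a j : ι} (has : a ∉ s) (hjs : j ∉ s)
    (hja : j ≠ a) {f₀ w₁ w₂ : (ι → X) → ℝ} {T V₁ V₂ : Set ι}
    (hf₀ : DependsOn f₀ (insert a (insert j T)))
    (hw₁ : DependsOn w₁ V₁) (hjV₁ : j ∉ V₁) (hTV₁ : ∀ i ∈ T, i ∉ V₁)
    (hw₂ : DependsOn w₂ V₂) (haV₂ : a ∉ V₂) (hsV₂ : ∀ i ∈ s, i ∉ V₂) (φ : ι → X) (u u' t t' : X)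
    (hw₂ne : ∀ ψ, w₂ ψ ≠ 0) (hG : ∀ ψ, coordAvg μ s w₁ ψ ≠ 0)
    (hM : ∀ ψ, coordAvg μ (insert a s) (fun η => f₀ η * w₁ η * w₂ η) ψ ≠ 0)
    (hblind : ∀ ψ ψ' : ι → X, (∀ i, i ≠ j → ψ i = ψ' i) →
      coordAvg μ s (fun η => f₀ η * w₁ η * w₂ η) ψ /
          coordAvg μ (insert a s) (fun η => f₀ η * w₁ η * w₂ η) ψ =
        coordAvg μ s (fun η => f₀ η * w₁ η * w₂ η) ψ' /
          coordAvg μ (insert a s) (fun η => f₀ η * w₁ η * w₂ η) ψ') :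
    coordAvg μ s f₀ (update (update φ a u) j t) * coordAvg μ s f₀ (update (update φ a u') j t') =
      coordAvg μ s f₀ (update (update φ a u) j t') * coordAvg μ s f₀ (update (update φ a u') j t) := by
  classical
  -- the four test configurations `φ[a ↦ v][j ↦ r]`
  let c : X → X → (ι → X) := fun v r => update (update φ a v) j r
  have hcdef : ∀ v r, update (update φ a v) j r = c v r := fun v r => rfl
  simp only [hcdef]
  -- numerator: `w₂` comes out of `A_s`; `f₀` and `w₁` read disjoint parts of `s`
  have hnum : ∀ v r, coordAvg μ s (fun η => f₀ η * w₁ η * w₂ η) (c v r) =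
      w₂ (c v r) * (coordAvg μ s f₀ (c v r) * coordAvg μ s w₁ (c v r)) := by
    intro v r
    have h1 : (fun η : ι → X => f₀ η * w₁ η * w₂ η) = fun η => w₂ η * (f₀ η * w₁ η) := by
      funext η; ring
    rw [h1, coordAvg_mul_left μ s (Φ := w₂) (H := fun η => f₀ η * w₁ η) ?_ (c v r),
      coordAvg_mul_of_disjoint_reads μ s hf₀ hw₁ ?_ (c v r)]
    · intro i hi hif hiV
      rcases Set.mem_insert_iff.1 hif with rfl | hif
      · exact has hi
      rcases Set.mem_insert_iff.1 hif with rfl | hiT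
      · exact hjs hi
      · exact hTV₁ i hiT hiV
    · intro ω ω'
      exact hw₂ fun i hi => Finset.piecewise_eq_of_notMem _ _ _ fun his => hsV₂ i his hi
  -- `A_s w₁` does not read `j`; `w₂` does not read `a`; the denominator does not read `a`
  have hGj : ∀ v r r', coordAvg μ s w₁ (c v r) = coordAvg μ s w₁ (c v r') := by
    intro v r r'
    refine coordAvg_congr_of_dependsOn μ s hw₁ fun i hi _ => ?_
    have hij : i ≠ j := fun h => hjV₁ (h ▸ hi)
    simp [c, update_of_ne hij]
  have hHa : ∀ v v' r, w₂ (c v r) = w₂ (c v' r) := by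
    intro v v' r
    refine hw₂ fun i hi => ?_
    have hia : i ≠ a := fun h => haV₂ (h ▸ hi)
    by_cases hij : i = j
    · subst hij; simp [c]
    · simp [c, update_of_ne hij, update_of_ne hia]
  have hMa : ∀ v v' r, coordAvg μ (insert a s) (fun η => f₀ η * w₁ η * w₂ η) (c v r) =
      coordAvg μ (insert a s) (fun η => f₀ η * w₁ η * w₂ η) (c v' r) := by
    intro v v' r
    refine coordAvg_congr_of_dependsOn μ (insert a s) (V := Set.univ)
      (fun x y h => by rw [show x = y from funext fun i => h i (Set.mem_univ i)]) fun i _ hi => ?_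
    have hia : i ≠ a := fun h => hi (h ▸ Finset.mem_insert_self a s)
    by_cases hij : i = j
    · subst hij; simp [c]
    · simp [c, update_of_ne hij, update_of_ne hia]
  -- blindness on the pairs `(c v t, c v t')`
  have hbl : ∀ v, coordAvg μ s (fun η => f₀ η * w₁ η * w₂ η) (c v t) /
      coordAvg μ (insert a s) (fun η => f₀ η * w₁ η * w₂ η) (c v t) =
      coordAvg μ s (fun η => f₀ η * w₁ η * w₂ η) (c v t') /
      coordAvg μ (insert a s) (fun η => f₀ η * w₁ η * w₂ η) (c v t') := by
    intro v
    refine hblind _ _ fun i hij => ?_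
    simp [c, update_of_ne hij]
  have e1 := hbl u
  have e2 := hbl u'
  rw [hnum, hnum] at e1 e2
  set K₁ := coordAvg μ s f₀ (c u t)
  set K₂ := coordAvg μ s f₀ (c u t')
  set K₃ := coordAvg μ s f₀ (c u' t)
  set K₄ := coordAvg μ s f₀ (c u' t')
  set G := coordAvg μ s w₁ (c u t) with hGdef
  set G' := coordAvg μ s w₁ (c u' t) with hG'def
  set H := w₂ (c u t) with hHdef
  set H' := w₂ (c u t') with hH'def
  set M := coordAvg μ (insert a s) (fun η => f₀ η * w₁ η * w₂ η) (c u t) with hMdef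
  set M' := coordAvg μ (insert a s) (fun η => f₀ η * w₁ η * w₂ η) (c u t') with hM'def
  rw [← hGj u t t', ← hGdef] at e1
  rw [hHa u' u t, ← hHdef, hHa u' u t', ← hH'def, ← hGj u' t t', ← hG'def, hMa u' u t, ← hMdef,
    hMa u' u t', ← hM'def] at e2
  -- e1 : H * (K₁ * G) / M = H' * (K₂ * G) / M' ;  e2 : H * (K₃ * G') / M = H' * (K₄ * G') / M'
  have hMne : M ≠ 0 := hM _
  have hM'ne : M' ≠ 0 := hM _
  rw [div_eq_div_iff hMne hM'ne] at e1 e2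
  have e1' : K₁ * (H * M') = K₂ * (H' * M) := mul_right_cancel₀ (hG _) (by linear_combination e1)
  have e2' : K₃ * (H * M') = K₄ * (H' * M) := mul_right_cancel₀ (hG _) (by linear_combination e2)
  have hα : H * M' ≠ 0 := mul_ne_zero (hw₂ne _) hM'ne
  exact mul_right_cancel₀ hα (by linear_combination K₄ * e1' - K₂ * e2')

/-- **A COMPOSED KERNEL THAT IS NOT OF PRODUCT FORM IS READ** (contrapositive): under the sorting of
`path_productForm_of_arConditional_blind`, if `K u t · K u' t' ≠ K u t' · K u' t` for some values of the
composed kernel `K v r = A_s f₀ (φ[a ↦ v][j ↦ r])`, there are two configurations agreeing off `j` with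
different conditionals `A_s w / A_{insert a s} w`. [ours] -/
theorem arConditional_reads_path (s : Finset ι) {a j : ι} (has : a ∉ s) (hjs : j ∉ s) (hja : j ≠ a)
    {f₀ w₁ w₂ : (ι → X) → ℝ} {T V₁ V₂ : Set ι}
    (hf₀ : DependsOn f₀ (insert a (insert j T)))
    (hw₁ : DependsOn w₁ V₁) (hjV₁ : j ∉ V₁) (hTV₁ : ∀ i ∈ T, i ∉ V₁)
    (hw₂ : DependsOn w₂ V₂) (haV₂ : a ∉ V₂) (hsV₂ : ∀ i ∈ s, i ∉ V₂)
    (hw₂ne : ∀ ψ, w₂ ψ ≠ 0) (hG : ∀ ψ, coordAvg μ s w₁ ψ ≠ 0)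
    (hM : ∀ ψ, coordAvg μ (insert a s) (fun η => f₀ η * w₁ η * w₂ η) ψ ≠ 0) {φ : ι → X}
    {u u' t t' : X}
    (hK : coordAvg μ s f₀ (update (update φ a u) j t) * coordAvg μ s f₀ (update (update φ a u') j t') ≠
      coordAvg μ s f₀ (update (update φ a u) j t') * coordAvg μ s f₀ (update (update φ a u') j t)) :
    ∃ ψ ψ' : ι → X, (∀ i, i ≠ j → ψ i = ψ' i) ∧
      coordAvg μ s (fun η => f₀ η * w₁ η * w₂ η) ψ /
          coordAvg μ (insert a s) (fun η => f₀ η * w₁ η * w₂ η) ψ ≠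
        coordAvg μ s (fun η => f₀ η * w₁ η * w₂ η) ψ' /
          coordAvg μ (insert a s) (fun η => f₀ η * w₁ η * w₂ η) ψ' := by
  by_contra hcon
  push Not at hcon
  exact hK (path_productForm_of_arConditional_blind μ s has hjs hja hf₀ hw₁ hjV₁ hTV₁ hw₂ haV₂ hsV₂ φ
    u u' t t' hw₂ne hG hM fun ψ ψ' h => hcon ψ ψ' h)

/-! ## §2 The path factor and its coordinate average: the composed kernel of `KernelCompositionTP2` -/

/-- **The path factor** from the current value `v` along the sites `p₁, …, p_k` to `j`:
`pathFactor F [(p₁,g₁,b₁), …, (p_k,g_k,b_k)] j v η = F(v, η p₁)·g₁(η p₁)·b₁(η p₁, η p₂) ⋯ g_k(η p_k)·b_k(η p_k, η j)`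
(`F` the bond out of the current variable; `g_i` the site weight at `p_i`; `b_i` the bond onward). [ours] -/
def pathFactor : (X → X → ℝ) → List (ι × (X → ℝ) × (X → X → ℝ)) → ι → X → (ι → X) → ℝ
  | F, [], j, v, η => F v (η j)
  | F, pgb :: rest, j, v, η => F v (η pgb.1) * pgb.2.1 (η pgb.1) * pathFactor pgb.2.2 rest j (η pgb.1) η

omit [Fintype ι] [DecidableEq ι] [MeasurableSpace X] in
/-- `pathFactor` through one more site. [ours] -/
@[simp] theorem pathFactor_cons (F : X → X → ℝ) (pgb : ι × (X → ℝ) × (X → X → ℝ))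
    (rest : List (ι × (X → ℝ) × (X → X → ℝ))) (j : ι) (v : X) (η : ι → X) :
    pathFactor F (pgb :: rest) j v η =
      F v (η pgb.1) * pgb.2.1 (η pgb.1) * pathFactor pgb.2.2 rest j (η pgb.1) η := rfl

omit [Fintype ι] [DecidableEq ι] [MeasurableSpace X] in
/-- **What the path factor reads**: only `j` and the path sites (besides the explicit value `v`).
[ours] -/
theorem dependsOn_pathFactor (path : List (ι × (X → ℝ) × (X → X → ℝ))) (j : ι) :
    ∀ (F : X → X → ℝ) (v : X),
      DependsOn (pathFactor F path j v) (insert j {i | i ∈ path.map Prod.fst}) := by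
  induction path with
  | nil => intro F v η η' h; simp [pathFactor, h j (Set.mem_insert _ _)]
  | cons pgb rest ih =>
    intro F v η η' h
    have hp : η pgb.1 = η' pgb.1 := h pgb.1 (Set.mem_insert_of_mem _ (by simp))
    rw [pathFactor_cons, pathFactor_cons, hp]
    congr 1
    exact ih pgb.2.2 (η' pgb.1) fun i hi => h i (by
      rcases Set.mem_insert_iff.1 hi with rfl | hi
      · exact Set.mem_insert _ _
      · exact Set.mem_insert_of_mem _ (by simp only [List.map_cons, List.mem_cons, Set.mem_setOf_eq] at hi ⊢; exact Or.inr hi))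

omit [Fintype ι] [DecidableEq ι] in
/-- The path factor is jointly measurable in (value, configuration) for jointly measurable bonds and
measurable site weights. [ours] -/
theorem measurable_pathFactor (path : List (ι × (X → ℝ) × (X → X → ℝ)))
    (hg : ∀ pgb ∈ path, Measurable pgb.2.1) (hb : ∀ pgb ∈ path, Measurable (uncurry pgb.2.2)) (j : ι) :
    ∀ F : X → X → ℝ, Measurable (uncurry F) →
      Measurable fun q : X × (ι → X) => pathFactor F path j q.1 q.2 := by
  induction path with
  | nil =>
    intro F hF
    exact hF.comp (measurable_fst.prodMk ((measurable_pi_apply j).comp measurable_snd))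
  | cons pgb rest ih =>
    intro F hF
    have hp : Measurable fun q : X × (ι → X) => q.2 pgb.1 := (measurable_pi_apply _).comp measurable_snd
    have ih' := ih (fun q hq => hg q (by simp [hq])) (fun q hq => hb q (by simp [hq])) pgb.2.2
      (hb pgb (by simp))
    simp only [pathFactor_cons]
    exact ((hF.comp (measurable_fst.prodMk hp)).mul ((hg pgb (by simp)).comp hp)).mul
      (ih'.comp (hp.prodMk measurable_snd))

omit [Fintype ι] [DecidableEq ι] [MeasurableSpace X] in
/-- The path factor of bounded data is bounded. [ours] -/
theorem pathFactor_bounded (path : List (ι × (X → ℝ) × (X → X → ℝ)))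
    (hg : ∀ pgb ∈ path, ∃ C, ∀ x, |pgb.2.1 x| ≤ C) (hb : ∀ pgb ∈ path, ∃ C, ∀ x t, |pgb.2.2 x t| ≤ C)
    (j : ι) : ∀ F : X → X → ℝ, (∃ C, ∀ u x, |F u x| ≤ C) →
      ∃ C, ∀ v η, |pathFactor F path j v η| ≤ C := by
  induction path with
  | nil => intro F ⟨C, hC⟩; exact ⟨C, fun v η => by simpa [pathFactor] using hC v (η j)⟩
  | cons pgb rest ih =>
    intro F ⟨CF, hCF⟩
    obtain ⟨Cg, hCg⟩ := hg pgb (by simp)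
    obtain ⟨C', hC'⟩ := ih (fun q hq => hg q (by simp [hq])) (fun q hq => hb q (by simp [hq])) pgb.2.2
      (hb pgb (by simp))
    refine ⟨CF * Cg * C', fun v η => ?_⟩
    rw [pathFactor_cons, abs_mul, abs_mul]
    have h0 : 0 ≤ CF := le_trans (abs_nonneg _) (hCF v v)
    have h1 : 0 ≤ Cg := le_trans (abs_nonneg _) (hCg v)
    exact mul_le_mul (mul_le_mul (hCF _ _) (hCg _) (abs_nonneg _) h0) (hC' _ _) (abs_nonneg _)
      (mul_nonneg h0 h1)

omit [Fintype ι] [IsProbabilityMeasure μ] in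
/-- One-site integration of the head of a path factor: integrating the first path site `p` (not read
again further down the path, `p ∉ rest`, `p ≠ j`) replaces `F, g, b` by the composed kernel
`compKernel μ F g b` of `Scaling/KernelCompositionTP2`. [ours] -/
theorem integral_pathFactor_head (F : X → X → ℝ) (pgb : ι × (X → ℝ) × (X → X → ℝ))
    (rest : List (ι × (X → ℝ) × (X → X → ℝ))) (j : ι) (hpj : pgb.1 ≠ j)
    (hp : pgb.1 ∉ rest.map Prod.fst) (v : X) (η : ι → X) :
    ∫ x, pathFactor F (pgb :: rest) j v (update η pgb.1 x) ∂μ =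
      pathFactor (compKernel μ F pgb.2.1 pgb.2.2) rest j v η := by
  -- below the head, the path factor does not read `p`: evaluate it at `η`
  have hrest : ∀ x y, pathFactor pgb.2.2 rest j y (update η pgb.1 x) = pathFactor pgb.2.2 rest j y η := by
    intro x y
    refine dependsOn_pathFactor rest j pgb.2.2 y fun i hi => ?_
    have : i ≠ pgb.1 := by
      rintro rfl
      rcases Set.mem_insert_iff.1 hi with h | h
      · exact hpj h
      · exact hp h
    exact update_of_ne this _ _
  simp only [pathFactor_cons, update_self, hrest]
  -- split off the head value of the remaining factor
  cases rest with
  | nil => simp [pathFactor, compKernel_apply]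
  | cons pgb' rest' =>
    simp only [pathFactor_cons, compKernel_apply]
    rw [← integral_mul_const (pgb'.2.1 (η pgb'.1)),
      ← integral_mul_const (pathFactor pgb'.2.2 rest' j (η pgb'.1) η)]
    refine integral_congr_ae (ae_of_all _ fun x => ?_)
    ring

/-- **INTEGRATING THE PATH SITES OF A PATH FACTOR GIVES THE COMPOSED KERNEL**: for a path with distinct
sites, none equal to `a` or `j`, bounded (jointly) measurable bonds and site weights,
`A_{p₁,…,p_k} (η ↦ pathFactor F path j (η a) η) (ω) = pathKernel μ F [(g₁,b₁),…,(g_k,b_k)] (ω a) (ω j)`.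
[ours] -/
theorem coordAvg_pathFactor (path : List (ι × (X → ℝ) × (X → X → ℝ))) {a j : ι}
    (hnd : (path.map Prod.fst).Nodup) (ha : a ∉ path.map Prod.fst) (hj : j ∉ path.map Prod.fst)
    (hg : ∀ pgb ∈ path, Measurable pgb.2.1 ∧ ∃ C, ∀ x, |pgb.2.1 x| ≤ C)
    (hb : ∀ pgb ∈ path, Measurable (uncurry pgb.2.2) ∧ ∃ C, ∀ x t, |pgb.2.2 x t| ≤ C) :
    ∀ F : X → X → ℝ, Measurable (uncurry F) → (∃ C, ∀ u x, |F u x| ≤ C) → ∀ ω : ι → X,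
      coordAvg μ (path.map Prod.fst).toFinset (fun η => pathFactor F path j (η a) η) ω =
        pathKernel μ F (path.map Prod.snd) (ω a) (ω j) := by
  induction path with
  | nil =>
    intro F _ _ ω
    simp [coordAvg_empty, pathFactor]
  | cons pgb rest ih =>
    intro F hFm hFb ω
    obtain ⟨CF, hCF⟩ := hFb
    have hp_rest : pgb.1 ∉ rest.map Prod.fst := (List.nodup_cons.1 (by simpa using hnd)).1
    have hnd' : (rest.map Prod.fst).Nodup := (List.nodup_cons.1 (by simpa using hnd)).2
    have hpa : pgb.1 ≠ a := fun h => ha (by simp [h])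
    have hpj : pgb.1 ≠ j := fun h => hj (by simp [h])
    have ha' : a ∉ rest.map Prod.fst := fun h => ha (by simp [h])
    have hj' : j ∉ rest.map Prod.fst := fun h => hj (by simp [h])
    obtain ⟨hgm, Cg, hgb⟩ := hg pgb (by simp)
    obtain ⟨hbm, CB, hbb⟩ := hb pgb (by simp)
    have hg' : ∀ q ∈ rest, Measurable q.2.1 ∧ ∃ C, ∀ x, |q.2.1 x| ≤ C := fun q hq => hg q (by simp [hq])
    have hb' : ∀ q ∈ rest, Measurable (uncurry q.2.2) ∧ ∃ C, ∀ x t, |q.2.2 x t| ≤ C :=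
      fun q hq => hb q (by simp [hq])
    -- the whole path factor is measurable and bounded (for the tower)
    have hq : Measurable fun η : ι → X => ((η a, η) : X × (ι → X)) :=
      (measurable_pi_apply a).prodMk measurable_id
    have hmeas : Measurable fun η : ι → X => pathFactor F (pgb :: rest) j (η a) η :=
      (measurable_pathFactor (pgb :: rest) (fun q hq => (hg q hq).1) (fun q hq => (hb q hq).1) j F
        hFm).comp hq
    obtain ⟨C, hC⟩ := pathFactor_bounded (pgb :: rest) (fun q hq => (hg q hq).2)
      (fun q hq => (hb q hq).2) j F ⟨CF, hCF⟩
    have hset : ((pgb :: rest).map Prod.fst).toFinset = insert pgb.1 (rest.map Prod.fst).toFinset := by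
      simp
    have hnot : pgb.1 ∉ (rest.map Prod.fst).toFinset := by simpa using hp_rest
    rw [hset, coordAvg_insert_of_bounded μ hnot hmeas (fun η => hC _ _) ω]
    -- the one-site average of the head
    have hhead : coordAvg μ {pgb.1} (fun η => pathFactor F (pgb :: rest) j (η a) η) =
        fun η => pathFactor (compKernel μ F pgb.2.1 pgb.2.2) rest j (η a) η := by
      funext η
      rw [coordAvg_singleton_of_measurable μ pgb.1 hmeas η]
      have : ∀ x, (update η pgb.1 x) a = η a := fun x => update_of_ne hpa.symm _ _
      simp only [this]
      exact integral_pathFactor_head μ F pgb rest j hpj hp_rest (η a) η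
    rw [hhead, ih hnd' ha' hj' hg' hb' (compKernel μ F pgb.2.1 pgb.2.2)
      (measurable_compKernel μ hFm hgm hbm) ⟨_, abs_compKernel_le μ hCF hgb hbb⟩ ω]
    simp

end Summit.Ventures.LatticeQCDFlow.Theory2.Autoregressive

end
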